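import Summits.Ventures.Crystal3D.Theorems.StickyWulffConstantGenericWallFloorAtHalfWideDown
import Summits.Ventures.Crystal3D.Theorems.StickyWulffConstantGenericWallFloorCoreResidual
import HarnessLib

/-!
# The two-sided word cell as a pure ORIENTATION condition: both end mirror planes inclined enough ⇒ `c₀ = 1`
# (crux `GenericWallFloor`, stmt-Ventures-19480, line `WallLedgerG`)

HONEST FRAMING. Venture `Summits/Ventures/Crystal3D` (cell `crystal3d-full`), helper `--supports` the crux `GenericWallFloor`
of `route-Ventures-StickyWulffConstant`, REGISTERED line `WallLedgerG`, open stub `stub_twoSlabAdhesion`.  Rung credit only;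
F-C1 not moved; NOT the crux (inputs `ExactOnly`(C12-55), `StarPairFar` BY NAME; an orientation class, not all pairs).
CENSUS-FREE corollary of `genericWallFloorAtCharge_word2_wide_of_inner` (p632813) with the hexagon bound
`exists_inPlane_slot_ge_sin` (p629531) and `image_fccSlots_eq_of_image_fcc_eq`: for a chain pair `A₂·Λ₀ = (wordFrame A₁ κ)·Λ₀`,
`|κ| ≥ 2`, with END mirror normals `ν₁ = A₁ μ_last` (grain 1) and `ν₂ = (wordFrame A₁ κ) μ_head` (grain 2) and
`rᵢ = √(1 − ⟪νᵢ, e₃⟫²)` (the sine of the inclination of the end mirror plane `i` to the slab plane):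
* `genericWallFloorAtCharge_word2_of_tilted_planes` — if `(√3/2) rᵢ ≥ 9/20` (`i = 1, 2`) then
  `GenericWallFloorAtCharge ((√6/4)(r₁ + r₂)) A₁ t₁ A₂ t₂` for ALL translations;
* `genericWallFloorAt_word2_of_tilted_planes` — if moreover `(√6/4)(r₁ + r₂) ≥ 1` then the crux's matrix `GenericWallFloorAt A₁ t₁ A₂ t₂`
  (`c₀ = 1`) for ALL translations.  (E.g. both end planes inclined `≥ 54.8°`, or one vertical and the other `≥ 39°`.)
No slot, capper or stack hypothesis remains: the statement is about the two end-plane inclinations only.  WHAT THIS IS NOT: the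
residual (memo TILT-COVERAGE-g7 §7: the open orientations are the caps `∠(e₃, T u₀) ≤ 16°`); F-C1 not moved.
-/

noncomputable section

namespace Summit.Ventures.Crystal3D.Theorems

open Summit.Ventures.Crystal3D Finset
open Literature.MathematicalPhysics.StatisticalMechanics (fccStacking barlowStacking IsHaggSeq)
open scoped InnerProductSpace

/-- A menu normal of the frame `wordFrame A₁ κ` is a menu normal of every frame `A₂` with the same lattice. -/
theorem menu_of_image_eq_wordFrame
    {A₁ A₂ : EuclideanSpace ℝ (Fin 3) ≃ₗᵢ[ℝ] EuclideanSpace ℝ (Fin 3)} {κ : List (EuclideanSpace ℝ (Fin 3))}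
    (hA₂ : A₂ '' fccStacking 1 (Real.sqrt (2 / 3)) = (wordFrame A₁ κ) '' fccStacking 1 (Real.sqrt (2 / 3)))
    {μ : EuclideanSpace ℝ (Fin 3)}
    (hμ : ∀ w ∈ fccSlots, ⟪w, μ⟫_ℝ = 0 ∨ ⟪w, μ⟫_ℝ = Real.sqrt (2 / 3) ∨ ⟪w, μ⟫_ℝ = -Real.sqrt (2 / 3)) :
    ∀ w ∈ fccSlots, ⟪A₂ w, wordFrame A₁ κ μ⟫_ℝ = 0 ∨ ⟪A₂ w, wordFrame A₁ κ μ⟫_ℝ = Real.sqrt (2 / 3) ∨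
      ⟪A₂ w, wordFrame A₁ κ μ⟫_ℝ = -Real.sqrt (2 / 3) := by
  intro w hw
  have himg := image_fccSlots_eq_of_image_fcc_eq A₂ (wordFrame A₁ κ) hA₂
  have hmem : A₂ w ∈ (wordFrame A₁ κ : EuclideanSpace ℝ (Fin 3) → EuclideanSpace ℝ (Fin 3)) '' ↑fccSlots := by
    rw [← himg]; exact ⟨w, Finset.mem_coe.2 hw, rfl⟩
  obtain ⟨w', hw', hww⟩ := hmem
  rw [← hww, LinearIsometryEquiv.inner_map_map]
  exact hμ w' (Finset.mem_coe.1 hw')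

open scoped Classical in
/-- **Two-sided word floor as an orientation condition.**  Chain pair `A₂·Λ₀ = (wordFrame A₁ κ)·Λ₀`, `|κ| ≥ 2`; end mirror
normals `ν₁ = A₁ μ_last`, `ν₂ = (wordFrame A₁ κ) μ_head`; if `(√3/2)√(1 − ⟪νᵢ,e₃⟫²) ≥ 9/20` for both then
`GenericWallFloorAtCharge ((√6/4)(√(1 − ⟪ν₁,e₃⟫²) + √(1 − ⟪ν₂,e₃⟫²)))`, modulo `ExactOnly`(C12-55) and `StarPairFar`. -/
theorem genericWallFloorAtCharge_word2_of_tilted_planes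
    {s₀ : EuclideanSpace ℝ (Fin 3)} (hs₀ : s₀ ∈ fccSlots)
    (hcert : ExactOnly 0 (fccSlots.filter fun w => 0 < ⟪w, s₀⟫_ℝ)) (hfar : StarPairFar)
    (A₁ : EuclideanSpace ℝ (Fin 3) ≃ₗᵢ[ℝ] EuclideanSpace ℝ (Fin 3)) (t₁ : EuclideanSpace ℝ (Fin 3))
    (A₂ : EuclideanSpace ℝ (Fin 3) ≃ₗᵢ[ℝ] EuclideanSpace ℝ (Fin 3)) (t₂ : EuclideanSpace ℝ (Fin 3))
    (κ : List (EuclideanSpace ℝ (Fin 3)))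
    (hκl : ∀ μ ∈ κ, ‖μ‖ = 1 ∧
      ∀ w ∈ fccSlots, ⟪w, μ⟫_ℝ = 0 ∨ ⟪w, μ⟫_ℝ = Real.sqrt (2 / 3) ∨ ⟪w, μ⟫_ℝ = -Real.sqrt (2 / 3))
    (hκc : List.IsChain (fun μ μ' => ⟪μ, μ'⟫_ℝ = 1 / 3 ∨ ⟪μ, μ'⟫_ℝ = -1 / 3) κ) (hκ2 : 2 ≤ κ.length)
    (hA₂ : A₂ '' fccStacking 1 (Real.sqrt (2 / 3)) = (wordFrame A₁ κ) '' fccStacking 1 (Real.sqrt (2 / 3)))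
    {μf : EuclideanSpace ℝ (Fin 3)} (hμf : κ.getLast? = some μf) {μh : EuclideanSpace ℝ (Fin 3)} (hμh : κ.head? = some μh)
    (h₁ : (9 / 20 : ℝ) ≤ Real.sqrt 3 / 2 * Real.sqrt (1 - ⟪A₁ μf, EuclideanSpace.single (2 : Fin 3) (1 : ℝ)⟫_ℝ ^ 2))
    (h₂ : (9 / 20 : ℝ) ≤ Real.sqrt 3 / 2 * Real.sqrt (1 - ⟪wordFrame A₁ κ μh, EuclideanSpace.single (2 : Fin 3) (1 : ℝ)⟫_ℝ ^ 2)) :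
    GenericWallFloorAtCharge (Real.sqrt 6 / 4 * (Real.sqrt (1 - ⟪A₁ μf, EuclideanSpace.single (2 : Fin 3) (1 : ℝ)⟫_ℝ ^ 2) +
        Real.sqrt (1 - ⟪wordFrame A₁ κ μh, EuclideanSpace.single (2 : Fin 3) (1 : ℝ)⟫_ℝ ^ 2))) A₁ t₁ A₂ t₂ := by
  set e : EuclideanSpace ℝ (Fin 3) := EuclideanSpace.single (2 : Fin 3) (1 : ℝ) with he
  set W := wordFrame A₁ κ with hW
  have hμfκ := hκl μf (List.mem_of_getLast? hμf)
  have hμhκ := hκl μh (List.mem_of_mem_head? hμh)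
  -- grain 1: an in-plane up-slot of its end mirror plane
  have hlt₁ : ⟪A₁ μf, e⟫_ℝ ^ 2 < 1 := by
    by_contra hge
    push Not at hge
    have : Real.sqrt (1 - ⟪A₁ μf, e⟫_ℝ ^ 2) = 0 := Real.sqrt_eq_zero'.2 (by linarith)
    rw [this, mul_zero] at h₁
    norm_num at h₁
  obtain ⟨w₁, hw₁, hw₁ν, hw₁e⟩ := exists_inPlane_slot_ge_sin A₁ (ν := A₁ μf) (by rw [LinearIsometryEquiv.norm_map, hμfκ.1])
    (fun w hw => by rw [LinearIsometryEquiv.inner_map_map]; exact hμfκ.2 w hw) hlt₁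
  have hup : (9 / 20 : ℝ) ≤ ⟪A₁ w₁, e⟫_ℝ := h₁.trans hw₁e
  have hfirst : ∀ μ, κ.getLast? = some μ → ⟪w₁, μ⟫_ℝ = 0 := fun μ' hμ' => by
    rw [hμf] at hμ'; obtain rfl := Option.some.inj hμ'
    rwa [LinearIsometryEquiv.inner_map_map] at hw₁ν
  -- grain 2: an in-plane down-slot of its end mirror plane (a menu plane of `A₂` because the lattices agree)
  have hlt₂ : ⟪W μh, e⟫_ℝ ^ 2 < 1 := by
    by_contra hge
    push Not at hge
    have : Real.sqrt (1 - ⟪W μh, e⟫_ℝ ^ 2) = 0 := Real.sqrt_eq_zero'.2 (by linarith)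
    rw [this, mul_zero] at h₂
    norm_num at h₂
  obtain ⟨w₂, hw₂, hw₂ν, hw₂e⟩ := exists_inPlane_slot_ge_sin A₂ (ν := W μh) (by rw [LinearIsometryEquiv.norm_map, hμhκ.1])
    (menu_of_image_eq_wordFrame hA₂ hμhκ.2) hlt₂
  have hw₂' : -w₂ ∈ fccSlots := neg_mem_fccSlots hw₂
  have hdown : ⟪A₂ (-w₂), e⟫_ℝ ≤ -(9 / 20 : ℝ) := by
    rw [map_neg, inner_neg_left]; linarith [h₂.trans hw₂e]
  have hlast : ∀ μ, κ.head? = some μ → ⟪A₂ (-w₂), W μ⟫_ℝ = 0 := fun μ' hμ' => by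
    rw [hμh] at hμ'; obtain rfl := Option.some.inj hμ'
    rw [map_neg, inner_neg_left, hw₂ν, neg_zero]
  have h := genericWallFloorAtCharge_word2_wide_of_inner hs₀ hcert hfar A₁ t₁ A₂ t₂ hw₁ hup hw₂' hdown κ hκl hκc hκ2 hA₂
    hfirst hlast
  refine genericWallFloorAtCharge_mono ?_ h
  have hb₁ : Real.sqrt 6 / 4 * Real.sqrt (1 - ⟪A₁ μf, e⟫_ℝ ^ 2) ≤ Real.sqrt 2 * |⟪A₁ w₁, e⟫_ℝ| / 2 :=
    sqrt6_div_four_mul_le (hw₁e.trans (le_abs_self _))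
  have habs : |⟪A₂ (-w₂), e⟫_ℝ| = ⟪A₂ w₂, e⟫_ℝ := by
    rw [map_neg, inner_neg_left, abs_neg, abs_of_nonneg (by linarith [h₂.trans hw₂e])]
  have hb₂ : Real.sqrt 6 / 4 * Real.sqrt (1 - ⟪W μh, e⟫_ℝ ^ 2) ≤ Real.sqrt 2 * |⟪A₂ (-w₂), e⟫_ℝ| / 2 := by
    rw [habs]; exact sqrt6_div_four_mul_le hw₂e
  linarith

open scoped Classical in
/-- **`c₀ = 1` from the two end-plane inclinations alone.**  As above, and `(√6/4)(√(1 − ⟪ν₁,e₃⟫²) + √(1 − ⟪ν₂,e₃⟫²)) ≥ 1`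
⇒ the crux's matrix `GenericWallFloorAt A₁ t₁ A₂ t₂` for all translations, modulo `ExactOnly`(C12-55) and `StarPairFar`. -/
theorem genericWallFloorAt_word2_of_tilted_planes
    {s₀ : EuclideanSpace ℝ (Fin 3)} (hs₀ : s₀ ∈ fccSlots)
    (hcert : ExactOnly 0 (fccSlots.filter fun w => 0 < ⟪w, s₀⟫_ℝ)) (hfar : StarPairFar)
    (A₁ : EuclideanSpace ℝ (Fin 3) ≃ₗᵢ[ℝ] EuclideanSpace ℝ (Fin 3)) (t₁ : EuclideanSpace ℝ (Fin 3))
    (A₂ : EuclideanSpace ℝ (Fin 3) ≃ₗᵢ[ℝ] EuclideanSpace ℝ (Fin 3)) (t₂ : EuclideanSpace ℝ (Fin 3))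
    (κ : List (EuclideanSpace ℝ (Fin 3)))
    (hκl : ∀ μ ∈ κ, ‖μ‖ = 1 ∧
      ∀ w ∈ fccSlots, ⟪w, μ⟫_ℝ = 0 ∨ ⟪w, μ⟫_ℝ = Real.sqrt (2 / 3) ∨ ⟪w, μ⟫_ℝ = -Real.sqrt (2 / 3))
    (hκc : List.IsChain (fun μ μ' => ⟪μ, μ'⟫_ℝ = 1 / 3 ∨ ⟪μ, μ'⟫_ℝ = -1 / 3) κ) (hκ2 : 2 ≤ κ.length)
    (hA₂ : A₂ '' fccStacking 1 (Real.sqrt (2 / 3)) = (wordFrame A₁ κ) '' fccStacking 1 (Real.sqrt (2 / 3)))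
    {μf : EuclideanSpace ℝ (Fin 3)} (hμf : κ.getLast? = some μf) {μh : EuclideanSpace ℝ (Fin 3)} (hμh : κ.head? = some μh)
    (h₁ : (9 / 20 : ℝ) ≤ Real.sqrt 3 / 2 * Real.sqrt (1 - ⟪A₁ μf, EuclideanSpace.single (2 : Fin 3) (1 : ℝ)⟫_ℝ ^ 2))
    (h₂ : (9 / 20 : ℝ) ≤ Real.sqrt 3 / 2 * Real.sqrt (1 - ⟪wordFrame A₁ κ μh, EuclideanSpace.single (2 : Fin 3) (1 : ℝ)⟫_ℝ ^ 2))
    (hsum : 1 ≤ Real.sqrt 6 / 4 * (Real.sqrt (1 - ⟪A₁ μf, EuclideanSpace.single (2 : Fin 3) (1 : ℝ)⟫_ℝ ^ 2) +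
        Real.sqrt (1 - ⟪wordFrame A₁ κ μh, EuclideanSpace.single (2 : Fin 3) (1 : ℝ)⟫_ℝ ^ 2))) :
    GenericWallFloorAt A₁ t₁ A₂ t₂ :=
  genericWallFloorAt_of_charge_one (genericWallFloorAtCharge_mono hsum
    (genericWallFloorAtCharge_word2_of_tilted_planes hs₀ hcert hfar A₁ t₁ A₂ t₂ κ hκl hκc hκ2 hA₂ hμf hμh h₁ h₂))

end Summit.Ventures.Crystal3D.Theorems

end
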